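import Literature.NumberTheory.Rogawski1990.ArchBouazizSurjectiveAssembly     -- ★ p851480 (this seat): `bouazizSurjOfForward_of_parts` (six organ hypotheses)
import Literature.NumberTheory.Rogawski1990.ArchBouazizLocalization           -- ★ (F0P3a-p06 (g20)): `exists_isCompact_bzClassMap_mem_of_archBzCompactSupport` ((Σ-SUPP))
import Literature.Analysis.Calculus.SmoothCutoffLocalization                  -- ★ p851476 (F0P3a-p06 (g20)): `exists_fin_contDiff_tsupport_subset_ball_sum_eq_one` ((Σ-PoU))
import Literature.NumberTheory.Rogawski1990.ArchBouazizStableFamilyLinear     -- ★ (S-lin) B (LH3-p02 (g5)): `ArchSmooth₂.finset_sum`, `stOrbFamH_finset_sum_of_mem_regS` ((Σ-ADD))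
import Literature.NumberTheory.Rogawski1990.ArchBouazizClassMultiplier       -- ★ p851490 (F0P3a-p04 (g25)): `exists_archSmooth₂_stOrbFamH_eq_classMul` ((Σ-MULT)) — ED. 2
import Literature.NumberTheory.Rogawski1990.ArchBouazizRegularGermsPaid     -- ★ p851586 (F0P3a-p04 (g25) over LH10-p02∕LH3-p03∕LH3-p04∕p09): `bzLocalSurjRegular` ((Σ-REG) PAID) — ED. 3
import Literature.NumberTheory.Rogawski1990.ArchBouazizWallSurjective       -- ★ p851665 (LH3-p01 (g6), W-road binder, over LH7-p04∕p06∕A-p12∕p09∕LH3-p02∕p08∕LH1-p03): `bzLocalSurjWall` ((Σ-WALL) PAID) — ED. 4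
import Literature.NumberTheory.Rogawski1990.ArchBouazizJumpStOrbFamHPaid    -- ★ p851464 (LH3-p03 (g6)): `exists_archBouazizSpaceH_stOrbFamH_leaf` (the FORWARD half, PAID) — ED. 4
import HarnessLib

/-!
# BOUAZIZ'S SURJECTIVITY FOR `H_∞`, MODULO ITS TWO LOCAL ORGANS: (Σ-PoU), (Σ-SUPP), (Σ-ADD) discharged by ★; what remains is local surjectivity at the regular base classes
# ((Σ-REG), in house) and at the wall base classes ((Σ-WALL), PRINT: Bouaziz 1994 §5.2 + [B1] Thm. 4.1.1), plus the class-function multiplier (Σ-MULT)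

Topic `NumberTheory/Rogawski1990`; namespace `Literature.NumberTheory.Rogawski1990`.  THEOREMS ONLY (no `def`, no instance, no notation, no axiom, no named fact, no `sorry`).
Cell `pub/hodgecm-mathlib`, crux H413 (`stmt-HodgeConjecture-24833`), line LH3 (closer stub `stub_N9`), letter L3′ SURJ-OF-FORWARD (RULINGS #22∕#23); binder LH10-p01 (g5).  Count-neutral.

WHAT.  ★ `bouazizSurjOfForward_of_parts` takes six organs at the frame `(L, νH, jcH)`.  Three of them are now theorems of the tree: (Σ-PoU) = ★ `exists_fin_contDiff_tsupport_subset_ball_sum_eq_one`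
(finite smooth partitions of unity subordinate to balls, F0P3a-p06), (Σ-SUPP) = ★ `exists_isCompact_bzClassMap_mem_of_archBzCompactSupport` ∘ ★ `ArchBouazizSpaceH.compactSupport`
(compact class-support, F0P3a-p06), (Σ-ADD) = ★ `ArchSmooth₂.finset_sum` + ★ `stOrbFamH_finset_sum_of_mem_regS` ((S-lin), LH3-p02).  **`bouazizSurjOfForward_of_mult_reg_wall`** keeps
the other three as hypotheses: (Σ-MULT) class-function multipliers of genuine families and (Σ-REG) local surjectivity at regular base classes (F0P3a-p04 (g25), in house), and
(Σ-WALL) local surjectivity at wall base classes — THE PRINT ORGAN of the road.  ED. 2 (`bouazizSurjOfForward_of_reg_wall`): (Σ-MULT) discharged too, by ★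
`exists_archSmooth₂_stOrbFamH_eq_classMul` (F0P3a-p04 (g25), p851490) — SURJ-OF-FORWARD = (Σ-REG) (in house) ⊕ (Σ-WALL) (PRINT).  ED. 3 (`bouazizSurjOfForward_of_wall`): (Σ-REG) discharged by ★ `bzLocalSurjRegular`
(F0P3a-p04 (g25), p851586) — SURJ-OF-FORWARD = (Σ-WALL) alone.  ED. 4 (`bouazizSurjOfForward`, `bouazizSurjective_stOrbFamH`): (Σ-WALL) discharged by ★ `bzLocalSurjWall`
(W-road, LH3-p01 (g6), p851665) and the forward half ★ `exists_archBouazizSpaceH_stOrbFamH_leaf` (LH3-p03 (g6), p851464) — LETTER L3′ IS A THEOREM OF THE TREE.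
HONEST LABEL: L3′ stays XL∕PRINT-labelled (Bouaziz 1994 Thm. 6.2.1; (Σ-WALL) PRINT) until paid; HC_CM is proved only modulo the 7 printed citations (2 remaining: hLiu418 =
stmt-HodgeConjecture-24832, h413 = stmt-HodgeConjecture-24833) until rung 0 closes; this file discharges bookkeeping organs only.

## References
* [Bouaziz1994IntegralesOrbitales] A. Bouaziz, *Intégrales orbitales sur les groupes de Lie réductifs*, Ann. Sci. ÉNS (4) 27 (1994) 573–609, §2.3 Lemme 2.3.1, §5.1 p. 588, §5.2,
  Thm. 6.2.1 (i) p. 592.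
* [Varadarajan1989] V. S. Varadarajan, *An Introduction to Harmonic Analysis on Semisimple Lie Groups*, Cambridge Stud. Adv. Math. 16 (1989), §6 p. 229.
-/

set_option autoImplicit false

noncomputable section

open MeasureTheory NumberField NumberField.InfinitePlace Complex Set Function Metric
open Literature.NumberTheory.Automorphic Literature.NumberTheory.Automorphic.UnitaryGroup Literature.NumberTheory.Automorphic.ArchCartan Literature.Analysis.Calculus
open scoped Classical ContDiff

namespace Literature.NumberTheory.Rogawski1990

section Modulo

variable (L : Type) [Field L] [NumberField L] [IsCMField L]
  [MeasurableSpace (↥(arch (↥(maximalRealSubfield L)) L (IsCMField.complexConj L) 2 (Matrix.of fun i j : Fin 2 => if i.val + j.val + 1 = 2 then (1 : L) else 0)) ×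
      ↥(arch (↥(maximalRealSubfield L)) L (IsCMField.complexConj L) 1 (Matrix.of fun i j : Fin 1 => if i.val + j.val + 1 = 1 then (1 : L) else 0)))]
  [BorelSpace (↥(arch (↥(maximalRealSubfield L)) L (IsCMField.complexConj L) 2 (Matrix.of fun i j : Fin 2 => if i.val + j.val + 1 = 2 then (1 : L) else 0)) ×
      ↥(arch (↥(maximalRealSubfield L)) L (IsCMField.complexConj L) 1 (Matrix.of fun i j : Fin 1 => if i.val + j.val + 1 = 1 then (1 : L) else 0)))]
  (νH : Measure (↥(arch (↥(maximalRealSubfield L)) L (IsCMField.complexConj L) 2 (Matrix.of fun i j : Fin 2 => if i.val + j.val + 1 = 2 then (1 : L) else 0)) ×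
      ↥(arch (↥(maximalRealSubfield L)) L (IsCMField.complexConj L) 1 (Matrix.of fun i j : Fin 1 => if i.val + j.val + 1 = 1 then (1 : L) else 0))))
  [νH.IsHaarMeasure] [νH.IsMulRightInvariant]

/-- **SURJ-OF-FORWARD MODULO (Σ-MULT), (Σ-REG), (Σ-WALL)**: at the frame `(L, νH, jcH)`, given the class-function multiplier of genuine families, local surjectivity (equality form) at the
base classes with distinct block eigenvalues everywhere, and local surjectivity at the wall base classes (PRINT), every member of `ArchBouazizSpaceH jcH` is, on the regular sets, the
stable orbital family of some `fH ∈ C_c^∞(H_∞)` — ★ `bouazizSurjOfForward_of_parts` with (Σ-PoU) ★ `exists_fin_contDiff_tsupport_subset_ball_sum_eq_one`, (Σ-SUPP) ★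
`exists_isCompact_bzClassMap_mem_of_archBzCompactSupport`, (Σ-ADD) ★ `ArchSmooth₂.finset_sum` + ★ `stOrbFamH_finset_sum_of_mem_regS`.
[cite: Bouaziz1994IntegralesOrbitales, §5.1 p. 588; Thm. 6.2.1 (i) p. 592] [cite: Varadarajan1989, §6 p. 229] -/
theorem bouazizSurjOfForward_of_mult_reg_wall (jcH : Finset {w : InfinitePlace L // IsComplex w} → {w : InfinitePlace L // IsComplex w} → ℂ)
    -- (Σ-MULT) class-function multipliers of genuine families
    (hmult : ∀ F : ({w : InfinitePlace L // IsComplex w} → ℂ × ℂ × ℂ) → ℂ, ContDiff ℝ ∞ F →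
      ∀ fH : ↥(arch (↥(maximalRealSubfield L)) L (IsCMField.complexConj L) 2 (Matrix.of fun i j : Fin 2 => if i.val + j.val + 1 = 2 then (1 : L) else 0)) ×
          ↥(arch (↥(maximalRealSubfield L)) L (IsCMField.complexConj L) 1 (Matrix.of fun i j : Fin 1 => if i.val + j.val + 1 = 1 then (1 : L) else 0)) → ℂ,
        ArchSmooth₂ L fH → ∃ fH' : ↥(arch (↥(maximalRealSubfield L)) L (IsCMField.complexConj L) 2 (Matrix.of fun i j : Fin 2 => if i.val + j.val + 1 = 2 then (1 : L) else 0)) ×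
            ↥(arch (↥(maximalRealSubfield L)) L (IsCMField.complexConj L) 1 (Matrix.of fun i j : Fin 1 => if i.val + j.val + 1 = 1 then (1 : L) else 0)) → ℂ,
          ArchSmooth₂ L fH' ∧ ∀ (S : Finset {w : InfinitePlace L // IsComplex w}) (c : {w : InfinitePlace L // IsComplex w} → Fin 3 → ℝ), c ∈ RegS S →
            stOrbFamH L νH fH' S c = F (bzClassMap S c) * stOrbFamH L νH fH S c)
    -- (Σ-REG) local surjectivity, equality form, at a base class with distinct block eigenvalues everywhere
    (hreg : ∀ b : {w : InfinitePlace L // IsComplex w} → ℂ × ℂ × ℂ, (∀ w, (b w).1 ^ 2 ≠ 4 * (b w).2.1) → ∃ ε : ℝ, 0 < ε ∧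
      ∀ Ψ : Finset {w : InfinitePlace L // IsComplex w} → ({w : InfinitePlace L // IsComplex w} → Fin 3 → ℝ) → ℂ, ArchBouazizSpaceH jcH Ψ →
        ∃ fH : ↥(arch (↥(maximalRealSubfield L)) L (IsCMField.complexConj L) 2 (Matrix.of fun i j : Fin 2 => if i.val + j.val + 1 = 2 then (1 : L) else 0)) ×
            ↥(arch (↥(maximalRealSubfield L)) L (IsCMField.complexConj L) 1 (Matrix.of fun i j : Fin 1 => if i.val + j.val + 1 = 1 then (1 : L) else 0)) → ℂ,
          ArchSmooth₂ L fH ∧ ∀ (S : Finset {w : InfinitePlace L // IsComplex w}) (c : {w : InfinitePlace L // IsComplex w} → Fin 3 → ℝ), c ∈ RegS S →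
            dist (bzClassMap S c) b < ε → stOrbFamH L νH fH S c = Ψ S c)
    -- (Σ-WALL) local surjectivity, equality form, at a wall base class — PRINT (Bouaziz §5.2 + [B1] Thm. 4.1.1; RULING #23)
    (hwall : ∀ b : {w : InfinitePlace L // IsComplex w} → ℂ × ℂ × ℂ, (∃ w, (b w).1 ^ 2 = 4 * (b w).2.1) → ∃ ε : ℝ, 0 < ε ∧
      ∀ Ψ : Finset {w : InfinitePlace L // IsComplex w} → ({w : InfinitePlace L // IsComplex w} → Fin 3 → ℝ) → ℂ, ArchBouazizSpaceH jcH Ψ →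
        ∃ fH : ↥(arch (↥(maximalRealSubfield L)) L (IsCMField.complexConj L) 2 (Matrix.of fun i j : Fin 2 => if i.val + j.val + 1 = 2 then (1 : L) else 0)) ×
            ↥(arch (↥(maximalRealSubfield L)) L (IsCMField.complexConj L) 1 (Matrix.of fun i j : Fin 1 => if i.val + j.val + 1 = 1 then (1 : L) else 0)) → ℂ,
          ArchSmooth₂ L fH ∧ ∀ (S : Finset {w : InfinitePlace L // IsComplex w}) (c : {w : InfinitePlace L // IsComplex w} → Fin 3 → ℝ), c ∈ RegS S →
            dist (bzClassMap S c) b < ε → stOrbFamH L νH fH S c = Ψ S c)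
    (Ψ : Finset {w : InfinitePlace L // IsComplex w} → ({w : InfinitePlace L // IsComplex w} → Fin 3 → ℝ) → ℂ) (hΨ : ArchBouazizSpaceH jcH Ψ) :
    ∃ fH : ↥(arch (↥(maximalRealSubfield L)) L (IsCMField.complexConj L) 2 (Matrix.of fun i j : Fin 2 => if i.val + j.val + 1 = 2 then (1 : L) else 0)) ×
        ↥(arch (↥(maximalRealSubfield L)) L (IsCMField.complexConj L) 1 (Matrix.of fun i j : Fin 1 => if i.val + j.val + 1 = 1 then (1 : L) else 0)) → ℂ,
      ArchSmooth₂ L fH ∧ ∀ S : Finset {w : InfinitePlace L // IsComplex w}, Set.EqOn (stOrbFamH L νH fH S) (Ψ S) (RegS S) := by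
  refine bouazizSurjOfForward_of_parts L νH jcH ?_ ?_ hmult ?_ hreg hwall Ψ hΨ
  · -- (Σ-PoU): ★ finite smooth partitions of unity subordinate to balls
    intro K hK ε hε
    obtain ⟨n, b, F, hF, hsum⟩ := exists_fin_contDiff_tsupport_subset_ball_sum_eq_one hK ε hε
    refine ⟨n, b, F, fun i => (hF i).2.1, fun i y hy => ?_, hsum⟩
    refine image_eq_zero_of_notMem_tsupport fun hmem => ?_
    have hball := (hF i).2.2.2.1 hmem
    rw [Metric.mem_ball] at hball
    exact (not_le.2 hball) hy
  · -- (Σ-SUPP): ★ compact class-support from (I₄)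
    intro Ψ' hΨ'
    exact exists_isCompact_bzClassMap_mem_of_archBzCompactSupport hΨ'.compactSupport
  · -- (Σ-ADD): ★ (S-lin) finite sums
    intro n fHs hfHs
    refine ⟨?_, fun S c hc => ?_⟩
    · have h := ArchSmooth₂.finset_sum Finset.univ (fun i _ => hfHs i)
      simpa only using h
    · have h := stOrbFamH_finset_sum_of_mem_regS L νH S Finset.univ (fun i _ => (hfHs i).continuous) (fun i _ => (hfHs i).hasCompactSupport) hc
      simpa only [Finset.sum_apply] using h

end Modulo

/-! ## ED. 2 — (Σ-MULT) discharged by ★ `exists_archSmooth₂_stOrbFamH_eq_classMul` (F0P3a-p04 (g25), p851490): SURJ-OF-FORWARD modulo (Σ-REG) and (Σ-WALL) only -/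

section ModuloTwo

variable (L : Type) [Field L] [NumberField L] [IsCMField L]
  [MeasurableSpace (↥(arch (↥(maximalRealSubfield L)) L (IsCMField.complexConj L) 2 (Matrix.of fun i j : Fin 2 => if i.val + j.val + 1 = 2 then (1 : L) else 0)) ×
      ↥(arch (↥(maximalRealSubfield L)) L (IsCMField.complexConj L) 1 (Matrix.of fun i j : Fin 1 => if i.val + j.val + 1 = 1 then (1 : L) else 0)))]
  [BorelSpace (↥(arch (↥(maximalRealSubfield L)) L (IsCMField.complexConj L) 2 (Matrix.of fun i j : Fin 2 => if i.val + j.val + 1 = 2 then (1 : L) else 0)) ×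
      ↥(arch (↥(maximalRealSubfield L)) L (IsCMField.complexConj L) 1 (Matrix.of fun i j : Fin 1 => if i.val + j.val + 1 = 1 then (1 : L) else 0)))]
  (νH : Measure (↥(arch (↥(maximalRealSubfield L)) L (IsCMField.complexConj L) 2 (Matrix.of fun i j : Fin 2 => if i.val + j.val + 1 = 2 then (1 : L) else 0)) ×
      ↥(arch (↥(maximalRealSubfield L)) L (IsCMField.complexConj L) 1 (Matrix.of fun i j : Fin 1 => if i.val + j.val + 1 = 1 then (1 : L) else 0))))
  [νH.IsHaarMeasure] [νH.IsMulRightInvariant]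

/-- **SURJ-OF-FORWARD MODULO ITS TWO LOCAL ORGANS** (ED. 2): at the frame `(L, νH, jcH)`, local surjectivity (equality form) at the base classes with distinct block eigenvalues
everywhere ((Σ-REG), in house) and at the wall base classes ((Σ-WALL), PRINT: Bouaziz 1994 §5.2 + [B1] Thm. 4.1.1) imply that every member of `ArchBouazizSpaceH jcH` is, on the regular
sets, the stable orbital family of some `fH ∈ C_c^∞(H_∞)` — ED. 1 with (Σ-MULT) := ★ `exists_archSmooth₂_stOrbFamH_eq_classMul` (the class-function multiplier `(F ∘ cl_H) · fH`).
[cite: Bouaziz1994IntegralesOrbitales, §5.1 p. 588; Thm. 6.2.1 (i) p. 592] [cite: Varadarajan1989, §6 p. 229] -/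
theorem bouazizSurjOfForward_of_reg_wall (jcH : Finset {w : InfinitePlace L // IsComplex w} → {w : InfinitePlace L // IsComplex w} → ℂ)
    -- (Σ-REG) local surjectivity, equality form, at a base class with distinct block eigenvalues everywhere
    (hreg : ∀ b : {w : InfinitePlace L // IsComplex w} → ℂ × ℂ × ℂ, (∀ w, (b w).1 ^ 2 ≠ 4 * (b w).2.1) → ∃ ε : ℝ, 0 < ε ∧
      ∀ Ψ : Finset {w : InfinitePlace L // IsComplex w} → ({w : InfinitePlace L // IsComplex w} → Fin 3 → ℝ) → ℂ, ArchBouazizSpaceH jcH Ψ →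
        ∃ fH : ↥(arch (↥(maximalRealSubfield L)) L (IsCMField.complexConj L) 2 (Matrix.of fun i j : Fin 2 => if i.val + j.val + 1 = 2 then (1 : L) else 0)) ×
            ↥(arch (↥(maximalRealSubfield L)) L (IsCMField.complexConj L) 1 (Matrix.of fun i j : Fin 1 => if i.val + j.val + 1 = 1 then (1 : L) else 0)) → ℂ,
          ArchSmooth₂ L fH ∧ ∀ (S : Finset {w : InfinitePlace L // IsComplex w}) (c : {w : InfinitePlace L // IsComplex w} → Fin 3 → ℝ), c ∈ RegS S →
            dist (bzClassMap S c) b < ε → stOrbFamH L νH fH S c = Ψ S c)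
    -- (Σ-WALL) local surjectivity, equality form, at a wall base class — PRINT (Bouaziz §5.2 + [B1] Thm. 4.1.1; RULING #23)
    (hwall : ∀ b : {w : InfinitePlace L // IsComplex w} → ℂ × ℂ × ℂ, (∃ w, (b w).1 ^ 2 = 4 * (b w).2.1) → ∃ ε : ℝ, 0 < ε ∧
      ∀ Ψ : Finset {w : InfinitePlace L // IsComplex w} → ({w : InfinitePlace L // IsComplex w} → Fin 3 → ℝ) → ℂ, ArchBouazizSpaceH jcH Ψ →
        ∃ fH : ↥(arch (↥(maximalRealSubfield L)) L (IsCMField.complexConj L) 2 (Matrix.of fun i j : Fin 2 => if i.val + j.val + 1 = 2 then (1 : L) else 0)) ×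
            ↥(arch (↥(maximalRealSubfield L)) L (IsCMField.complexConj L) 1 (Matrix.of fun i j : Fin 1 => if i.val + j.val + 1 = 1 then (1 : L) else 0)) → ℂ,
          ArchSmooth₂ L fH ∧ ∀ (S : Finset {w : InfinitePlace L // IsComplex w}) (c : {w : InfinitePlace L // IsComplex w} → Fin 3 → ℝ), c ∈ RegS S →
            dist (bzClassMap S c) b < ε → stOrbFamH L νH fH S c = Ψ S c)
    (Ψ : Finset {w : InfinitePlace L // IsComplex w} → ({w : InfinitePlace L // IsComplex w} → Fin 3 → ℝ) → ℂ) (hΨ : ArchBouazizSpaceH jcH Ψ) :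
    ∃ fH : ↥(arch (↥(maximalRealSubfield L)) L (IsCMField.complexConj L) 2 (Matrix.of fun i j : Fin 2 => if i.val + j.val + 1 = 2 then (1 : L) else 0)) ×
            ↥(arch (↥(maximalRealSubfield L)) L (IsCMField.complexConj L) 1 (Matrix.of fun i j : Fin 1 => if i.val + j.val + 1 = 1 then (1 : L) else 0)) → ℂ,
      ArchSmooth₂ L fH ∧ ∀ S : Finset {w : InfinitePlace L // IsComplex w}, Set.EqOn (stOrbFamH L νH fH S) (Ψ S) (RegS S) :=
  bouazizSurjOfForward_of_mult_reg_wall L νH jcH (fun F hF fH hfH => exists_archSmooth₂_stOrbFamH_eq_classMul L νH F hF fH hfH) hreg hwall Ψ hΨ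

end ModuloTwo

/-! ## ED. 3 — (Σ-REG) discharged by ★ `bzLocalSurjRegular` (F0P3a-p04 (g25), p851586, over ★ (Σ4b) p851507, ★ (Σ4c) p851569 (LH10-p02 ∕ LH3-p03), ★ (Σ4d) p851525∕p851533 (LH3-p04),
★ (Σ4-img) p851511 (F0P3a-p09)): SURJ-OF-FORWARD modulo (Σ-WALL) ONLY -/

section ModuloWall

variable (L : Type) [Field L] [NumberField L] [IsCMField L]
  [MeasurableSpace (↥(arch (↥(maximalRealSubfield L)) L (IsCMField.complexConj L) 2 (Matrix.of fun i j : Fin 2 => if i.val + j.val + 1 = 2 then (1 : L) else 0)) ×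
      ↥(arch (↥(maximalRealSubfield L)) L (IsCMField.complexConj L) 1 (Matrix.of fun i j : Fin 1 => if i.val + j.val + 1 = 1 then (1 : L) else 0)))]
  [BorelSpace (↥(arch (↥(maximalRealSubfield L)) L (IsCMField.complexConj L) 2 (Matrix.of fun i j : Fin 2 => if i.val + j.val + 1 = 2 then (1 : L) else 0)) ×
      ↥(arch (↥(maximalRealSubfield L)) L (IsCMField.complexConj L) 1 (Matrix.of fun i j : Fin 1 => if i.val + j.val + 1 = 1 then (1 : L) else 0)))]
  (νH : Measure (↥(arch (↥(maximalRealSubfield L)) L (IsCMField.complexConj L) 2 (Matrix.of fun i j : Fin 2 => if i.val + j.val + 1 = 2 then (1 : L) else 0)) ×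
      ↥(arch (↥(maximalRealSubfield L)) L (IsCMField.complexConj L) 1 (Matrix.of fun i j : Fin 1 => if i.val + j.val + 1 = 1 then (1 : L) else 0))))
  [νH.IsHaarMeasure] [νH.IsMulRightInvariant]

/-- **SURJ-OF-FORWARD MODULO THE WALL ORGAN ALONE** (ED. 3): at the frame `(L, νH, jcH)` with `jcH` forward-compatible (`hfwd`), local surjectivity at the wall base classes ((Σ-WALL):
Bouaziz 1994 §5.2 + [B1] Thm. 4.1.1, the W-road of LH3-p01 (g6)) implies that every member of `ArchBouazizSpaceH jcH` is, on the regular sets, the stable orbital family of some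
`fH ∈ C_c^∞(H_∞)` — ED. 2 with (Σ-REG) := ★ `bzLocalSurjRegular L νH jcH hfwd` (the class-function multiplier road at every base class with distinct block eigenvalues everywhere).
[cite: Bouaziz1994IntegralesOrbitales, §5.1 p. 588; Thm. 6.2.1 (i) p. 592] [cite: Varadarajan1989, §6 p. 229] -/
theorem bouazizSurjOfForward_of_wall (jcH : Finset {w : InfinitePlace L // IsComplex w} → {w : InfinitePlace L // IsComplex w} → ℂ)
    (hfwd : ∀ fH : ↥(arch (↥(maximalRealSubfield L)) L (IsCMField.complexConj L) 2 (Matrix.of fun i j : Fin 2 => if i.val + j.val + 1 = 2 then (1 : L) else 0)) ×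
            ↥(arch (↥(maximalRealSubfield L)) L (IsCMField.complexConj L) 1 (Matrix.of fun i j : Fin 1 => if i.val + j.val + 1 = 1 then (1 : L) else 0)) → ℂ,
      ArchSmooth₂ L fH → ArchBouazizSpaceH jcH (stOrbFamH L νH fH))
    -- (Σ-WALL) local surjectivity, equality form, at a wall base class (Bouaziz §5.2 + [B1] Thm. 4.1.1; W-road ★ `bzLocalSurjWall_of_parts` modulo its bricks)
    (hwall : ∀ b : {w : InfinitePlace L // IsComplex w} → ℂ × ℂ × ℂ, (∃ w, (b w).1 ^ 2 = 4 * (b w).2.1) → ∃ ε : ℝ, 0 < ε ∧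
      ∀ Ψ : Finset {w : InfinitePlace L // IsComplex w} → ({w : InfinitePlace L // IsComplex w} → Fin 3 → ℝ) → ℂ, ArchBouazizSpaceH jcH Ψ →
        ∃ fH : ↥(arch (↥(maximalRealSubfield L)) L (IsCMField.complexConj L) 2 (Matrix.of fun i j : Fin 2 => if i.val + j.val + 1 = 2 then (1 : L) else 0)) ×
            ↥(arch (↥(maximalRealSubfield L)) L (IsCMField.complexConj L) 1 (Matrix.of fun i j : Fin 1 => if i.val + j.val + 1 = 1 then (1 : L) else 0)) → ℂ,
          ArchSmooth₂ L fH ∧ ∀ (S : Finset {w : InfinitePlace L // IsComplex w}) (c : {w : InfinitePlace L // IsComplex w} → Fin 3 → ℝ), c ∈ RegS S →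
            dist (bzClassMap S c) b < ε → stOrbFamH L νH fH S c = Ψ S c)
    (Ψ : Finset {w : InfinitePlace L // IsComplex w} → ({w : InfinitePlace L // IsComplex w} → Fin 3 → ℝ) → ℂ) (hΨ : ArchBouazizSpaceH jcH Ψ) :
    ∃ fH : ↥(arch (↥(maximalRealSubfield L)) L (IsCMField.complexConj L) 2 (Matrix.of fun i j : Fin 2 => if i.val + j.val + 1 = 2 then (1 : L) else 0)) ×
            ↥(arch (↥(maximalRealSubfield L)) L (IsCMField.complexConj L) 1 (Matrix.of fun i j : Fin 1 => if i.val + j.val + 1 = 1 then (1 : L) else 0)) → ℂ,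
      ArchSmooth₂ L fH ∧ ∀ S : Finset {w : InfinitePlace L // IsComplex w}, Set.EqOn (stOrbFamH L νH fH S) (Ψ S) (RegS S) :=
  bouazizSurjOfForward_of_reg_wall L νH jcH (fun b hb => bzLocalSurjRegular L νH jcH hfwd b hb) hwall Ψ hΨ

end ModuloWall

/-! ## ED. 4 — (Σ-WALL) discharged by ★ `bzLocalSurjWall` (W-road, LH3-p01 (g6), p851665): BOUAZIZ'S SURJECTIVITY FOR `H_∞` IS A THEOREM OF THE TREE, and with the forward half
★ `exists_archBouazizSpaceH_stOrbFamH_leaf` (LH3-p03 (g6), p851464) the whole letter L3′ (`BouazizSurjectiveStatement`'s body) at every frame `(L, νH)` -/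

section Paid

variable (L : Type) [Field L] [NumberField L] [IsCMField L]
  [MeasurableSpace (↥(arch (↥(maximalRealSubfield L)) L (IsCMField.complexConj L) 2 (Matrix.of fun i j : Fin 2 => if i.val + j.val + 1 = 2 then (1 : L) else 0)) ×
      ↥(arch (↥(maximalRealSubfield L)) L (IsCMField.complexConj L) 1 (Matrix.of fun i j : Fin 1 => if i.val + j.val + 1 = 1 then (1 : L) else 0)))]
  [BorelSpace (↥(arch (↥(maximalRealSubfield L)) L (IsCMField.complexConj L) 2 (Matrix.of fun i j : Fin 2 => if i.val + j.val + 1 = 2 then (1 : L) else 0)) ×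
      ↥(arch (↥(maximalRealSubfield L)) L (IsCMField.complexConj L) 1 (Matrix.of fun i j : Fin 1 => if i.val + j.val + 1 = 1 then (1 : L) else 0)))]
  (νH : Measure (↥(arch (↥(maximalRealSubfield L)) L (IsCMField.complexConj L) 2 (Matrix.of fun i j : Fin 2 => if i.val + j.val + 1 = 2 then (1 : L) else 0)) ×
      ↥(arch (↥(maximalRealSubfield L)) L (IsCMField.complexConj L) 1 (Matrix.of fun i j : Fin 1 => if i.val + j.val + 1 = 1 then (1 : L) else 0))))
  [νH.IsHaarMeasure] [νH.IsMulRightInvariant]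

/-- **SURJ-OF-FORWARD, PAID** (ED. 4; `BouazizSurjOfForwardStatement`'s body at the frame `(L, νH, jcH)`): for every forward-compatible jump datum `jcH`, every member of Bouaziz's space
`ArchBouazizSpaceH jcH` is, on the regular sets, the stable orbital family of some `fH ∈ C_c^∞(H_∞)` — ED. 3 with (Σ-WALL) := ★ `bzLocalSurjWall L νH jcH hfwd` (the FILTRATION road
of Bouaziz 1994 §4∕§5.1 specialised to `H_∞`, typed in house by the W-road).  Bouaziz 1994 Thm. 6.2.1 (i) «`J^st_G : D(U) → I^st(U)` est surjective» for `H_∞ = U(1,1)^W × U(1)^W`.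
[cite: Bouaziz1994IntegralesOrbitales, Thm. 6.2.1 (i) p. 592; §5.1 p. 588] [cite: Shelstad1979, Thm. 4.7 (p. 31)] -/
theorem bouazizSurjOfForward (jcH : Finset {w : InfinitePlace L // IsComplex w} → {w : InfinitePlace L // IsComplex w} → ℂ)
    (hfwd : ∀ fH : ↥(arch (↥(maximalRealSubfield L)) L (IsCMField.complexConj L) 2 (Matrix.of fun i j : Fin 2 => if i.val + j.val + 1 = 2 then (1 : L) else 0)) ×
            ↥(arch (↥(maximalRealSubfield L)) L (IsCMField.complexConj L) 1 (Matrix.of fun i j : Fin 1 => if i.val + j.val + 1 = 1 then (1 : L) else 0)) → ℂ,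
      ArchSmooth₂ L fH → ArchBouazizSpaceH jcH (stOrbFamH L νH fH))
    (Ψ : Finset {w : InfinitePlace L // IsComplex w} → ({w : InfinitePlace L // IsComplex w} → Fin 3 → ℝ) → ℂ) (hΨ : ArchBouazizSpaceH jcH Ψ) :
    ∃ fH : ↥(arch (↥(maximalRealSubfield L)) L (IsCMField.complexConj L) 2 (Matrix.of fun i j : Fin 2 => if i.val + j.val + 1 = 2 then (1 : L) else 0)) ×
            ↥(arch (↥(maximalRealSubfield L)) L (IsCMField.complexConj L) 1 (Matrix.of fun i j : Fin 1 => if i.val + j.val + 1 = 1 then (1 : L) else 0)) → ℂ,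
      ArchSmooth₂ L fH ∧ ∀ S : Finset {w : InfinitePlace L // IsComplex w}, Set.EqOn (stOrbFamH L νH fH S) (Ψ S) (RegS S) :=
  bouazizSurjOfForward_of_wall L νH jcH hfwd (fun b hb => bzLocalSurjWall L νH jcH hfwd b hb) Ψ hΨ

/-- **LETTER L3′ AT THE FRAME `(L, νH)` — BOUAZIZ'S THEOREM 6.2.1 FOR `H_∞`, IN HOUSE** (`BouazizSurjectiveStatement`'s body): ONE jump datum `jcH`, non-zero at every wall, such that the
normalised stable orbital families of all of `C_c^∞(H_∞)` lie in `ArchBouazizSpaceH jcH` (FORWARD half ★ `exists_archBouazizSpaceH_stOrbFamH_leaf`) AND every member of that space is such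
a family on the regular sets (SURJ-OF-FORWARD above). [cite: Bouaziz1994IntegralesOrbitales, Thm. 6.2.1 (i) p. 592] [cite: Shelstad1979, Thm. 4.7 (p. 31)] -/
theorem bouazizSurjective_stOrbFamH :
    ∃ jcH : Finset {w : InfinitePlace L // IsComplex w} → {w : InfinitePlace L // IsComplex w} → ℂ,
      (∀ (S : Finset {w : InfinitePlace L // IsComplex w}) (w : {w : InfinitePlace L // IsComplex w}), w ∉ S → jcH S w ≠ 0) ∧
      (∀ fH : ↥(arch (↥(maximalRealSubfield L)) L (IsCMField.complexConj L) 2 (Matrix.of fun i j : Fin 2 => if i.val + j.val + 1 = 2 then (1 : L) else 0)) ×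
            ↥(arch (↥(maximalRealSubfield L)) L (IsCMField.complexConj L) 1 (Matrix.of fun i j : Fin 1 => if i.val + j.val + 1 = 1 then (1 : L) else 0)) → ℂ,
        ArchSmooth₂ L fH → ArchBouazizSpaceH jcH (stOrbFamH L νH fH)) ∧
      ∀ Ψ : Finset {w : InfinitePlace L // IsComplex w} → ({w : InfinitePlace L // IsComplex w} → Fin 3 → ℝ) → ℂ, ArchBouazizSpaceH jcH Ψ →
        ∃ fH : ↥(arch (↥(maximalRealSubfield L)) L (IsCMField.complexConj L) 2 (Matrix.of fun i j : Fin 2 => if i.val + j.val + 1 = 2 then (1 : L) else 0)) ×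
            ↥(arch (↥(maximalRealSubfield L)) L (IsCMField.complexConj L) 1 (Matrix.of fun i j : Fin 1 => if i.val + j.val + 1 = 1 then (1 : L) else 0)) → ℂ,
          ArchSmooth₂ L fH ∧ ∀ S : Finset {w : InfinitePlace L // IsComplex w}, Set.EqOn (stOrbFamH L νH fH S) (Ψ S) (RegS S) := by
  obtain ⟨jcH, hne, hfwd⟩ := exists_archBouazizSpaceH_stOrbFamH_leaf L νH
  exact ⟨jcH, hne, hfwd, fun Ψ hΨ => bouazizSurjOfForward L νH jcH hfwd Ψ hΨ⟩

end Paid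

end Literature.NumberTheory.Rogawski1990

end
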